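/-
Copyright: harness tree, Literature layer (sorry-free). b2b-lace enum1-g34 (ENUMERATION SHARD A gen 34),
D10-HYBRID census node D10H-1b: the SEEDCERT kernel evaluator with the DIMENSION AS A PARAMETER
(computable layer; additive companion of `SrwSeedCertKernel`, whose dimension is the literal `11`).
-/
import Literature.Probability.FitznerVanDerHofstad2017.SrwSeedCertKernel

/-!
# SEEDCERT kernel evaluator, dimension-parametric computable layer

`SrwSeedCertKernel` evaluates seed certificates for the SRW integrals `I_{n,0}(x; 11) = srwI 11 n 0 x`
with the dimension hard-wired (`Cert.lam := 11 * t²`, `22^{M̂}`, Horner base `484 = 22²`,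
`(2π)^{-11/2}`, tail exponents `11 - 2n`, prefactor `11^n/(n-1)!`).  This file is the ADDITIVE
dimension-parametric companion: for a certificate `c : SeedCert.Cert` (the SAME record) and a dimension
`D : ℕ` it defines `c.lamD D = D t²`, the `D`-padded coordinate list `c.avalsD D`, the Poisson block
over `(2D)^{M̂}` with Horner base `(2D)²` (`hornerB`), the `√(2π)`-power brackets
`1/sHi^D ≤ (2π)^{-D/2} ≤ 1/sLo^D`, the `D`-fold bracket products, the tail exponents `D - 2n`, the
prefactor `D^n/(n-1)!`, and the four Boolean checks `paramsOKD / poissonCheckD / tailCheckD / finalCheckD`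
(conjunction `checkD`).  Every dimension-free kernel (`wHatFold`, `facSeq`, `expSeq`, `loProdPN`,
`upProdPN`, `tailInt`, `epsBoundQ`, `loFloor`, the `e^{-1}` and `π` brackets) is IMPORTED from
`SrwSeedCertKernel`, not copied.  `paramsOKD` additionally checks `9 ≤ D` (the Bessel `u`-split
`srwI_succ_zero_eq_integral_Ioc_add_integral_Ioi` needs `2(n-1)+3 ≤ D` for `n ≤ 4`) and
`coords.length ≤ D`.  Soundness (`Cert.soundD`: `checkD`-conjuncts ⟹ `lo n ≤ srwI D n 0 x ≤ hi n`) is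
`SrwSeedCertSoundD`; the meaning of each quantity is `SrwSeedCertSemanticsD`.  At `D = 11` these
definitions agree with `SrwSeedCertKernel`'s except for the (equivalent, slightly different) rational
form of the `(2π)^{-D/2}` brackets.

[cite: FitznerVanDerHofstad2016NoBLE, §5.1.1 (5.4)–(5.5) pp. 1089–1090]
-/

namespace Literature.Probability.FitznerVanDerHofstad2017.SeedCert

open Finset

/-! ### Horner accumulation with a base parameter -/

/-- Horner accumulation `acc ↦ acc · B + w_k f_k` along two lists (stops at the shorter):
`hornerAuxB B [w₀,…] [f₀,…,f_{c-1}] 0 = Σ_{k<c} w_k f_k B^{c-1-k}` (`hornerAux` is the case `B = 484`).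
Structural in both lists. [folklore] -/
def hornerAuxB (B : ℕ) : List ℕ → List ℕ → ℕ → ℕ
  | w :: ws, f :: fs, acc => hornerAuxB B ws fs (acc * B + w * f)
  | _, _, acc => acc

/-- See `hornerAuxB`. [folklore] -/
def hornerB (B : ℕ) (w f : List ℕ) : ℕ := hornerAuxB B w f 0

namespace Cert

variable (c : Cert) (D : ℕ)

/-- `λ = D·T = D t²`. [cite: FitznerVanDerHofstad2016NoBLE, §5.1.1 (5.4)–(5.5) pp. 1089–1090] -/
def lamD : ℕ := D * c.t ^ 2

/-- The full list of the `D` coordinate absolute values (`coords` padded with zeros to length `D`;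
meaningful when `coords.length ≤ D`, which `paramsOKD` checks). [cite: FitznerVanDerHofstad2016NoBLE, §5.1.1 (5.4)–(5.5) pp. 1089–1090] -/
def avalsD : List ℕ := c.coords ++ List.replicate (D - c.coords.length) 0

/-- The hat half-table `[Ŵ_0, …, Ŵ_K]`, `Ŵ_k = M̂! · W_{2k+A}(x; D)/(2k+A)!`. [cite: FitznerVanDerHofstad2016NoBLE, §5.1.1 (5.4)–(5.5) pp. 1089–1090] -/
def whatD : List ℕ := wHatFold (prodRange 0 c.Mh) c.K (c.avalsD D)

/-- The Horner base `(2D)²`. [cite: FitznerVanDerHofstad2016NoBLE, §5.1.1 (5.4)–(5.5) pp. 1089–1090] -/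
def baseD : ℕ := (2 * D) ^ 2

/-- The common denominator `n'! · M̂! · (2D)^{M̂}` of `P_n` and `U_n` (`n' = n - 1`). [cite: FitznerVanDerHofstad2016NoBLE, §5.1.1 (5.4)–(5.5) pp. 1089–1090] -/
def denD (n : ℕ) : ℚ := ((n - 1).factorial : ℚ) * (prodRange 0 c.Mh : ℚ) * (((2 * D : ℕ) : ℚ)) ^ c.Mh

/-- Numerator of `P_n`: `Σ_{k < cnt n} ŵ_k (A+2k+n')! (2D)^{M̂-A-2k} = ((2D)²)^{K+1-cnt n} · hornerB`. [cite: FitznerVanDerHofstad2016NoBLE, §5.1.1 (5.4)–(5.5) pp. 1089–1090] -/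
def NPD (w : List ℕ) (n : ℕ) : ℕ :=
  baseD D ^ (c.K + 1 - c.cnt n) * hornerB (baseD D) w (facSeq (c.A + (n - 1)) (c.cnt n))

/-- Numerator of `U_n`: `Σ_{k < cnt n} ŵ_k A_{A+2k+n'} (2D)^{M̂-A-2k} = ((2D)²)^{K+1-cnt n} · hornerB`. [cite: FitznerVanDerHofstad2016NoBLE, §5.1.1 (5.4)–(5.5) pp. 1089–1090] -/
def NUD (w : List ℕ) (n : ℕ) : ℕ :=
  baseD D ^ (c.K + 1 - c.cnt n) * hornerB (baseD D) w (expSeq (c.lamD D) (c.A + (n - 1)) (c.cnt n))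

/-- `P_n = Σ_{m < M n} C(m+n', n') p_m(x; D)`, exactly (`w` = the hat half-table). [cite: FitznerVanDerHofstad2016NoBLE, §5.1.1 (5.4)–(5.5) pp. 1089–1090] -/
def PqD (w : List ℕ) (n : ℕ) : ℚ := (c.NPD D w n : ℚ) / c.denD D n

/-- `U_n = Σ_{m<M n} C(m+n',n') p_m(x; D) A_{m+n'}/(m+n')!`, so that
`e^{-λ} U_n = Σ C(m+n',n') p_m E_{m+n'+1}(λ)`. [cite: FitznerVanDerHofstad2016NoBLE, §5.1.1 (5.4)–(5.5) pp. 1089–1090] -/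
def UqD (w : List ℕ) (n : ℕ) : ℚ := (c.NUD D w n : ℚ) / c.denD D n

/-- `r⁻ = expNegOneLo^λ ≤ e^{-λ}`. [cite: FitznerVanDerHofstad2016NoBLE, §5.1.1 (5.4)–(5.5) pp. 1089–1090] -/
def rLoD : ℚ := expNegOneLo ^ c.lamD D

/-- `e^{-λ} ≤ r⁺ = expNegOneHi^λ`. [cite: FitznerVanDerHofstad2016NoBLE, §5.1.1 (5.4)–(5.5) pp. 1089–1090] -/
def rHiD : ℚ := expNegOneHi ^ c.lamD D

/-- The majorant `R⁺_n` of the Poisson-tail remainder `Σ_{m ≥ M} C(m+n',n') p_m Q(λ, m+n'+1)`: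
`r⁺ · θ · θ' · λ^{M+n'+1} / (n'! · M! · (M+n'+1))`, `θ = (M+n'+2)/(M+n'+2-λ)`, `θ' = (M+1)/(M+1-λ)`. [cite: FitznerVanDerHofstad2016NoBLE, §5.1.1 (5.4)–(5.5) pp. 1089–1090] -/
def RplusD (n : ℕ) : ℚ :=
  c.rHiD D * (((c.M n + n + 1 : ℕ) : ℚ) / (((c.M n + n + 1 : ℕ) : ℚ) - (c.lamD D : ℚ))) *
    (((c.M n + 1 : ℕ) : ℚ) / (((c.M n + 1 : ℕ) : ℚ) - (c.lamD D : ℚ))) *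
    (c.lamD D : ℚ) ^ (c.M n + n) / (((n - 1).factorial : ℚ) * ((c.M n).factorial : ℚ) * ((c.M n + n : ℕ) : ℚ))

/-- `κ⁻ = 1/sHi^D ≤ (2π)^{-D/2}` (`√(2π) ≤ sHi`). [cite: FitznerVanDerHofstad2016NoBLE, §5.1.1 (5.4)–(5.5) pp. 1089–1090] -/
def kLoD : ℚ := 1 / c.sHi ^ D

/-- `(2π)^{-D/2} ≤ κ⁺ = 1/sLo^D` (`sLo ≤ √(2π)`). [cite: FitznerVanDerHofstad2016NoBLE, §5.1.1 (5.4)–(5.5) pp. 1089–1090] -/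
def kHiD : ℚ := 1 / c.sLo ^ D

/-- The scaled product `PL` of the `D` lower bracket polynomials (positive/negative parts). [cite: FitznerVanDerHofstad2016NoBLE, §5.1.1 (5.4)–(5.5) pp. 1089–1090] -/
def plPND : List ℕ × List ℕ := loProdPN c.J c.eps c.S (c.avalsD D)

/-- The scaled product of the `D` UPPER bracket polynomials. [cite: FitznerVanDerHofstad2016NoBLE, §5.1.1 (5.4)–(5.5) pp. 1089–1090] -/
def puPND : List ℕ × List ℕ := upProdPN c.J c.eps c.S (c.avalsD D)

/-- The scale `2^{D S}` of the products. [cite: FitznerVanDerHofstad2016NoBLE, §5.1.1 (5.4)–(5.5) pp. 1089–1090] -/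
def scaleD : ℚ := (2 : ℚ) ^ (D * c.S)

/-- `∫_T^∞ u^{n-1-D/2} P(1/u) du` for a scaled product `pl` with value `P · 2^{D S}` (exact; tail
exponents `D - 2n + 2i`): with `pl = plPND` this is `IL_n`, with `pl = puPND` it is `IU_n`. [cite: FitznerVanDerHofstad2016NoBLE, §5.1.1 (5.4)–(5.5) pp. 1089–1090] -/
def tailOfD (pl : List ℕ × List ℕ) (n : ℕ) : ℚ := tailInt c.t pl (D - 2 * n) / c.scaleD D

/-- `IL_n = ∫_T^∞ u^{n-1-D/2} PL(1/u) du`. [cite: FitznerVanDerHofstad2016NoBLE, §5.1.1 (5.4)–(5.5) pp. 1089–1090] -/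
def ILD (n : ℕ) : ℚ := c.tailOfD D (c.plPND D) n

/-- `IU_n = ∫_T^∞ u^{n-1-D/2} PU(1/u) du`. [cite: FitznerVanDerHofstad2016NoBLE, §5.1.1 (5.4)–(5.5) pp. 1089–1090] -/
def IUD (n : ℕ) : ℚ := c.tailOfD D (c.puPND D) n

/-- `c_n = D^n/(n-1)!`, the prefactor of the `u`-representation of `srwI D n 0`. [cite: FitznerVanDerHofstad2016NoBLE, §5.1.1 (5.4)–(5.5) pp. 1089–1090] -/
def prefD (n : ℕ) : ℚ := (D : ℚ) ^ n / ((n - 1).factorial : ℚ)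

/-- The certified LOWER bound of `srwI D n 0 x`, assembled from the intermediate brackets. [cite: FitznerVanDerHofstad2016NoBLE, §5.1.1 (5.4)–(5.5) pp. 1089–1090] -/
def loFinalD (n : ℕ) : ℚ := c.pLo n - c.rHiD D * c.uHi n + prefD D n * c.kLoD D * c.ilLo n

/-- The certified UPPER bound of `srwI D n 0 x`, assembled from the intermediate brackets. [cite: FitznerVanDerHofstad2016NoBLE, §5.1.1 (5.4)–(5.5) pp. 1089–1090] -/
def hiFinalD (n : ℕ) : ℚ :=
  c.pHi n - c.rLoD D * c.uLo n + c.RplusD D n + prefD D n * c.kHiD D * c.iuHi n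

/-- Parameter sanity: `0 < s₀ < 1`, `(J + 3/2)/(2 s₀²) ≤ T`, `0 < t`, `M̂ = 2K + A`, at most `D`
listed coordinates, `9 ≤ D`, `√(2π)` brackets, and for every coordinate value the bracket constant,
the positivity floor and the dyadic integrality of the scaled coefficients; per seed index
`1 ≤ M n ≤ M̂ + 1`, `cnt n ≤ K + 1` and `λ + 1 < M n`. (Kernel cost: seconds.) [cite: FitznerVanDerHofstad2016NoBLE, §5.1.1 (5.4)–(5.5) pp. 1089–1090] -/
def paramsOKD : Bool :=
  decide (0 < c.s0) && decide (c.s0 < 1) && decide (((c.J : ℚ) + 3 / 2) / (2 * c.s0 ^ 2) ≤ (c.t : ℚ) ^ 2) &&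
  decide (0 < c.t) && (c.Mh == 2 * c.K + c.A) && decide (c.coords.length ≤ D) && decide (9 ≤ D) &&
  decide (0 < c.nexp) &&
  decide (0 < c.sLo) && decide (c.sLo ^ 2 ≤ 2 * piLo) && decide (0 < c.sHi) && decide (2 * piHi ≤ c.sHi ^ 2) &&
  decide (0 ≤ expNegOneLo) &&
  (c.avalsD D).all (fun a =>
    decide (0 ≤ c.eps a) &&
    decide (epsBoundQ a c.J c.s0 c.t c.sHi c.nexp ≤ c.eps a) &&
    decide (0 ≤ loFloor a c.J (c.eps a) c.h) &&
    (loList a c.J (c.eps a)).all (dyadicOK c.S) && (upList a c.J (c.eps a)).all (dyadicOK c.S)) &&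
  (List.range 4).all (fun i =>
    decide (1 ≤ c.M (i + 1)) && decide (c.M (i + 1) ≤ c.Mh + 1) && decide (c.cnt (i + 1) ≤ c.K + 1) &&
    decide (c.lamD D + 1 < c.M (i + 1)))

/-- **Walk-count layer check**: the exact `P_n`, `U_n` (computed from the kernel-evaluated hat table)
lie in the generator's brackets `[pLo n, pHi n]`, `[uLo n, uHi n]`. (Kernel cost: the hat table.) [cite: FitznerVanDerHofstad2016NoBLE, §5.1.1 (5.4)–(5.5) pp. 1089–1090] -/
def poissonCheckD : Bool :=
  let w := c.whatD D
  (List.range 4).all fun i =>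
    decide (c.pLo (i + 1) ≤ c.PqD D w (i + 1)) && decide (c.PqD D w (i + 1) ≤ c.pHi (i + 1)) &&
    decide (c.uLo (i + 1) ≤ c.UqD D w (i + 1)) && decide (c.UqD D w (i + 1) ≤ c.uHi (i + 1))

/-- **Tail layer check**: `ilLo n ≤ IL_n` and `IU_n ≤ iuHi n` for the kernel-evaluated product of the
`D` bracket polynomials. (Kernel cost: the product.) [cite: FitznerVanDerHofstad2016NoBLE, §5.1.1 (5.4)–(5.5) pp. 1089–1090] -/
def tailCheckD : Bool :=
  let pl := c.plPND D
  let pu := c.puPND D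
  (List.range 4).all fun i =>
    decide (c.ilLo (i + 1) ≤ c.tailOfD D pl (i + 1)) && decide (c.tailOfD D pu (i + 1) ≤ c.iuHi (i + 1))

/-- **Final check**: `0 ≤ uLo n`, `0 ≤ ilLo n`, and the assembled bounds sit inside the target
interval: `lo n ≤ loFinalD n`, `hiFinalD n ≤ hi n`. (Kernel cost: seconds.) [cite: FitznerVanDerHofstad2016NoBLE, §5.1.1 (5.4)–(5.5) pp. 1089–1090] -/
def finalCheckD : Bool :=
  (List.range 4).all fun i =>
    decide (0 ≤ c.uLo (i + 1)) && decide (0 ≤ c.ilLo (i + 1)) &&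
    decide (c.lo (i + 1) ≤ c.loFinalD D (i + 1)) && decide (c.hiFinalD D (i + 1) ≤ c.hi (i + 1))

/-- **The dimension-`D` certificate check** (the conjunction; a class file proves the four conjuncts as
separate `decide +kernel` theorems). [cite: FitznerVanDerHofstad2016NoBLE, §5.1.1 (5.4)–(5.5) pp. 1089–1090] -/
def checkD : Bool := c.paramsOKD D && c.finalCheckD D && c.poissonCheckD D && c.tailCheckD D

end Cert

end Literature.Probability.FitznerVanDerHofstad2017.SeedCert
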